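import Literature.Computability.Complexity.ArthurMerlinGamesProofs
import Literature.Computability.Complexity.PRGDerandomization
import HarnessLib

/-!
# The two-move game `MA`: its value, and Arthur's predicate as a small circuit
# (toolkit for the proof of IKW 2002, Thm. 12)

Literature / complexity toolkit. Impagliazzo–Kabanets–Wigderson's Theorem 12 (`IKWGenerators.lean`:
a nondeterministic generator of hard truth tables derandomizes `MA`) is, as printed, IKW's
Theorem 11 (a pseudorandom generator from a hard truth table) followed by the Goldreich–Zuckerman
simulation of `MA`: Arthur's coins are replaced by the outputs of the generator on all seeds, which
is correct as soon as the generator fools ARTHUR'S PREDICATE `z ↦ R(x, y, z)` for the input `x` and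
Merlin's message `y` at hand. This file supplies the two facts about the tree's `MA = MA(2)`
(`ArthurMerlinGames.lean`: referee `Ref ∈ P`, moves of a common polynomial length `m`, thresholds
`2/3`, `1/3`) that this argument consumes:

* `amValue_merlin_arthur` — **the value of the two-move game `MA`** is
  `max_{y ∈ {0,1}^m} Pr_{z ∈ {0,1}^m}[⟨x, enc (y, z)⟩ ∈ Ref]` (Babai–Moran 1988, §2.3: a Merlin node
  is the maximum, an Arthur node the average); hence `forall_uniformProb_le_of_amValue_le` (value
  `≤ 1/3` ⟹ EVERY message of Merlin is accepted with probability `≤ 1/3`) and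
  `exists_le_uniformProb_of_le_amValue` (value `≥ 2/3` ⟹ SOME message is accepted with probability
  `≥ 2/3`); `mem_MA_iff` unfolds membership in `MA`;
* the referee read on triples, `⟨⟨x, y⟩, z⟩ ↦ ⟨x, enc (y, z)⟩` (the preimage under `AMTwo.toRefFn`,
  `ArthurMerlinGamesProofs.lean`, in `P` for `Ref ∈ P`); **`MATests.exists_circuit`** — for `Ref ∈ P` there is a polynomial `q` such that for all `x`, `y`
  and `m ≤ N` Arthur's predicate `r ↦ [⟨x, enc (y, r↾m)⟩ ∈ Ref]` on `N` input bits is a `B₂`-circuit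
  of size `≤ q(2|x| + |y| + m)` (`P ⊆ P/poly` with `⟨x, y⟩` hard-wired: `exists_circuit_hardwire` of
  `PRGDerandomization.lean`, Arora–Barak's proof of Lemma 20.3 / IKW's "approximate the acceptance
  probability of a Boolean circuit"), together with `MATests.card_random_eq_uniformProb`: its
  acceptance frequency on a uniform `r ∈ {0,1}^N` is `Pr_{z ∈ {0,1}^m}[⟨x, enc (y, z)⟩ ∈ Ref]`.

Everything is proved, no definitions; Mathlib has no Arthur–Merlin classes; nothing duplicates the tree (searched
`merlin, arthur`, `amValue_merlin`, `toRefFn`, `circuit_hardwire`: the `[arthur, merlin]` value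
`amValue_arthur_merlin` and the one-move values exist, the `[merlin, arthur]` value did not).

## References

* R. Impagliazzo, V. Kabanets, A. Wigderson, *In search of an easy witness: exponential time vs.
  probabilistic polynomial time*, JCSS 65 (2002) 672–694, §2.1 (definition of `MA` by a predicate
  `R(x, y, z)`), §2.4 (the paragraph before Thm. 12) [ImpagliazzoKabanetsWigderson2002].
* L. Babai, S. Moran, *Arthur–Merlin games: a randomized proof system, and a hierarchy of
  complexity classes*, JCSS 36 (1988) 254–276, §2.3 (evaluation of the game tree) [BabaiMoran1988].
* S. Arora, B. Barak, *Computational Complexity: A Modern Approach*, CUP 2009, Def. 8.10 (`MA`),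
  proof of Lemma 20.3 (the predicate with the input hard-wired is a small circuit), Thm. 6.6
  [AroraBarakCC2009].
-/

noncomputable section

namespace Literature.Computability.Complexity

open _root_.Computability Finset AMPlayer

/-! ### The value of the two-move game `MA` -/

/-- **Value of the two-move game `MA`**: Merlin moves `y`, then Arthur tosses `z`; the value is
`max_{y ∈ {0,1}^m} Pr_{z ∈ {0,1}^m}[⟨x, enc (y, z)⟩ ∈ Ref]` (a Merlin node is worth the maximum over
his moves, an Arthur node the average of the 0/1 payoffs). [cite: BabaiMoran1988, §2.3] -/
theorem amValue_merlin_arthur (Ref : Language Bool) (m : ℕ) (x : List Bool) :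
    amValue Ref m [merlin, arthur] x =
      (univ : Finset (List.Vector Bool m)).sup' univ_nonempty fun y =>
        uniformProb m {z | boolPair x (encMoves [y.toList, z]) ∈ Ref} := by
  unfold amValue
  rw [gameValue_merlin]
  refine sup'_congr _ rfl fun y _ => ?_
  refine gameValue_arthur_of_zeroOne (fun z => boolPair x (encMoves [y.toList, z]) ∈ Ref)
    (fun z hz => ?_) (fun z hz => ?_)
  · rw [gameValue_nil, List.nil_append, List.singleton_append, refereePayoff_of_mem hz]
  · rw [gameValue_nil, List.nil_append, List.singleton_append, refereePayoff_of_not_mem hz]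

/-- **Soundness reading**: if the `MA` game on `x` is worth at most `c`, then EVERY message of
Merlin is accepted with probability at most `c`. [cite: BabaiMoran1988, §2.3] -/
theorem forall_uniformProb_le_of_amValue_le {Ref : Language Bool} {m : ℕ} {x : List Bool} {c : ℝ}
    (h : amValue Ref m [merlin, arthur] x ≤ c) (y : List.Vector Bool m) :
    uniformProb m {z | boolPair x (encMoves [y.toList, z]) ∈ Ref} ≤ c := by
  rw [amValue_merlin_arthur, sup'_le_iff] at h
  exact h y (mem_univ y)

/-- **Completeness reading**: if the `MA` game on `x` is worth at least `c`, then SOME message of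
Merlin is accepted with probability at least `c`. [cite: BabaiMoran1988, §2.3] -/
theorem exists_le_uniformProb_of_le_amValue {Ref : Language Bool} {m : ℕ} {x : List Bool} {c : ℝ}
    (h : c ≤ amValue Ref m [merlin, arthur] x) :
    ∃ y : List.Vector Bool m, c ≤ uniformProb m {z | boolPair x (encMoves [y.toList, z]) ∈ Ref} := by
  rw [amValue_merlin_arthur, le_sup'_iff] at h
  obtain ⟨y, -, hy⟩ := h
  exact ⟨y, hy⟩

/-- **Membership in `MA = MA(2)`**, unfolded: a referee `Ref ∈ P` and a move-length polynomial `m`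
such that the two-move game (Merlin, then Arthur) is worth `≥ 2/3` on members and `≤ 1/3` on
non-members. [cite: AroraBarakCC2009, Def. 8.10] -/
theorem mem_MA_iff {L : Language Bool} :
    L ∈ MA ↔ ∃ Ref ∈ Classes.P, ∃ m : Polynomial ℕ, ∀ x : List Bool,
      (x ∈ L → (2 / 3 : ℝ) ≤ amValue Ref (m.eval x.length) [merlin, arthur] x) ∧
        (x ∉ L → amValue Ref (m.eval x.length) [merlin, arthur] x ≤ 1 / 3) :=
  Iff.rfl

/-! ### Arthur's predicate as a small circuit -/

namespace MATests

/-- **Arthur's predicate read on triples**: `⟨⟨x, y⟩, z⟩ ∈ toRefFn ⁻¹' Ref ↔ ⟨x, enc (y, z)⟩ ∈ Ref`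
(the preimage of the referee under the re-association `AMTwo.toRefFn`; in `P` for `Ref ∈ P` by
`preimage_mem_P`). [cite: AroraBarakCC2009, Def. 8.10] -/
theorem mem_preimage_toRefFn_iff (Ref : Language Bool) (x y z : List Bool) :
    boolPair (boolPair x y) z ∈ (AMTwo.toRefFn ⁻¹' Ref : Language Bool) ↔
      boolPair x (encMoves [y, z]) ∈ Ref := by
  change AMTwo.toRefFn (boolPair (boolPair x y) z) ∈ Ref ↔ _
  rw [AMTwo.toRefFn_apply]

/-- The indicator of the preimage on a triple. [folklore] -/
theorem boolIndicator_preimage_toRefFn (Ref : Language Bool) (x y z : List Bool) :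
    (AMTwo.toRefFn ⁻¹' Ref : Language Bool).boolIndicator (boolPair (boolPair x y) z) =
      Ref.boolIndicator (boolPair x (encMoves [y, z])) := by
  change (Ref.boolIndicator ∘ AMTwo.toRefFn) _ = _
  rw [Function.comp_apply, AMTwo.toRefFn_apply]

/-- The coin event of `toRefFn ⁻¹' Ref` at `⟨x, y⟩` is Arthur's acceptance event for the message
`y`. [folklore] -/
theorem coinEvent_preimage_toRefFn (Ref : Language Bool) (x y : List Bool) :
    PRGDerand.coinEvent (AMTwo.toRefFn ⁻¹' Ref) (boolPair x y) =
      {z | boolPair x (encMoves [y, z]) ∈ Ref} := by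
  ext z
  exact mem_preimage_toRefFn_iff Ref x y z

/-- **Arthur's predicate with `⟨x, y⟩` hard-wired is a small circuit** (IKW §2.4: "the truth table
of a hard Boolean function can be used in order to approximate the acceptance probability of a
Boolean circuit of appropriate size"; Arora–Barak, proof of Lemma 20.3, via `P ⊆ P/poly`,
Thm. 6.6): for `Ref ∈ P` there is a polynomial `q` such that for all strings `x`, `y` and all
`m ≤ N` some `B₂`-circuit on `N` inputs of size `≤ q(2|x| + |y| + m)` has value
`[⟨x, enc (y, r↾m)⟩ ∈ Ref]` at every `r ∈ {0,1}^N` (it reads only the first `m` inputs).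
[cite: ImpagliazzoKabanetsWigderson2002, §2.4] [cite: AroraBarakCC2009, Lemma 20.3 (proof)] -/
theorem exists_circuit {Ref : Language Bool} (hRef : Ref ∈ Classes.P) :
    ∃ q : Polynomial ℕ, ∀ (x y : List Bool) (m N : ℕ) (hmN : m ≤ N),
      ∃ C : Circuit (Fin N), C.IsOver B2 ∧ C.size ≤ q.eval (2 * x.length + y.length + m) ∧
        ∀ r, C.eval r = Ref.boolIndicator
          (boolPair x (encMoves [y, List.ofFn fun j : Fin m => r (Fin.castLE hmN j)])) := by
  obtain ⟨q, hq⟩ := exists_cktSize_boolPair_of_mem_PPoly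
    (P_subset_PPoly_holds (preimage_mem_P hRef AMTwo.toRefFn_mem_FP))
  -- the size `(2n + 2 + m) + q(2n + 2 + m) + 2` at `n = 2|x| + 2 + |y|`, as a polynomial in `2|x| + |y| + m`
  refine ⟨(2 * Polynomial.X + 6) + q.comp (2 * Polynomial.X + 6) + 2, fun x y m N hmN => ?_⟩
  obtain ⟨C, hB, hs, hC⟩ := exists_circuit_hardwire (hq (boolPair x y).length m) (boolPair x y) rfl hmN
  refine ⟨C, hB, hs.trans ?_, fun r => ?_⟩
  · have hl : 2 * (boolPair x y).length + 2 + m ≤ 2 * (2 * x.length + y.length + m) + 6 := by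
      rw [length_boolPair]; omega
    have hq' : q.eval (2 * (boolPair x y).length + 2 + m) ≤ q.eval (2 * (2 * x.length + y.length + m) + 6) :=
      TM2Iter.eval_mono q hl
    simp only [Polynomial.eval_add, Polynomial.eval_mul, Polynomial.eval_ofNat, Polynomial.eval_X,
      Polynomial.eval_comp]
    omega
  · rw [hC r, boolIndicator_preimage_toRefFn]

/-- **The acceptance frequency of Arthur's circuit on uniform coins** is
`Pr_{z ∈ {0,1}^m}[⟨x, enc (y, z)⟩ ∈ Ref]` (the circuit reads only `r↾m`, and restriction of a uniform
string is uniform). [cite: AroraBarakCC2009, Lemma 20.3 (proof)] -/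
theorem card_random_eq_uniformProb (Ref : Language Bool) (x y : List Bool) {m N : ℕ} (hmN : m ≤ N)
    (C : Circuit (Fin N))
    (hC : ∀ r, C.eval r = Ref.boolIndicator
      (boolPair x (encMoves [y, List.ofFn fun j : Fin m => r (Fin.castLE hmN j)]))) :
    (#{r : Fin N → Bool | C.eval r = true} : ℝ) / 2 ^ N =
      uniformProb m {z | boolPair x (encMoves [y, z]) ∈ Ref} := by
  rw [← coinEvent_preimage_toRefFn]
  refine PRGDerand.card_random_eq_uniformProb (AMTwo.toRefFn ⁻¹' Ref) (boolPair x y) hmN C fun r => ?_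
  rw [hC r, boolIndicator_preimage_toRefFn]

/-- **The vector form of the acceptance probability**: counting coin vectors `z : Fin m → Bool`
instead of strings. [folklore] -/
theorem card_filter_eq_uniformProb (Ref : Language Bool) (x y : List Bool) (m : ℕ) :
    (#{v : Fin m → Bool | Ref.boolIndicator (boolPair x (encMoves [y, List.ofFn v])) = true} : ℝ) /
        2 ^ m =
      uniformProb m {z | boolPair x (encMoves [y, z]) ∈ Ref} := by
  classical
  have h1 : (univ.filter fun v : Fin m → Bool =>
      Ref.boolIndicator (boolPair x (encMoves [y, List.ofFn v])) = true) =
      univ.filter fun v : Fin m → Bool => List.ofFn v ∈ {z | boolPair x (encMoves [y, z]) ∈ Ref} :=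
    Finset.filter_congr fun v _ => by rw [← Set.mem_iff_boolIndicator]; rfl
  rw [h1, card_filter_ofFn_mem_eq_cnt, uniformProb_eq_cnt_div]

end MATests

end Literature.Computability.Complexity

end
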